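import Summits.NavierStokesRegularity.NavierStokesRegularity.Theses.ExtremalTypeIConstant
import Summits.NavierStokesRegularity.NavierStokesRegularity.Theorems.ExtremalTypeIConstantSpiralScalingLiouvilleCore
import Summits.NavierStokesRegularity.NavierStokesRegularity.Theorems.TypeICertificateLadderTargetSolitonBridgeEquivalence
import HarnessLib

/-!
# Route `ExtremalTypeIConstant`, crux `SpiralScalingLiouville` (stmt-NavierStokesRegularity-8216):
# the crux IS Pineau–Vicol's Conjecture 1.1 (all rates) and IS the window stub B5b of crux `Target` — kernel-checked

Summits-side theorem file (kind = proof, no definitions) of line `registered` (lead c1). The tree already identifies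
the sibling crux `SymmetryModuliCount.SymmetricLiouville` (stmt-4053) with Liouville for ALL Type-I rotated
self-similar solutions of Pineau–Vicol's class (`solitonBridge_symmetricLiouville_iff_rssLiouville`) and with the
registered open window stub B5b `stub_windowLiouville` of crux `Target` (stmt-1217)
(`solitonBridge_windowLiouville_iff_symmetricLiouville`); `ExtremalTypeIConstantSpiralScalingLiouvilleCore.lean`
identifies this crux with stmt-4053 (`spiralScalingLiouville_iff_symmetricLiouville`). Composing:

* `spiralScalingLiouville_iff_rssLiouvillePV` — the crux ⇔ Pineau–Vicol Conj. 1.1 in their class, every rate `α`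
  (classical on `[−1,0)`, apex bound `‖u(t,x)‖ ≤ C₀/(‖x‖ + √(−t))`, `u = pvAnsatz α U`, `U ∈ C²` ⇒ `U = 0`);
* `spiralScalingLiouville_iff_windowLiouville` — the crux ⇔ B5b VERBATIM (the compact-window statement with the landed
  rotating conjugate density, soliton law and identity as hypotheses; Pineau–Vicol Thm 1.4 and the landed stubs B1–B4
  of that line absorb everything off the window);
* `spiralScalingLiouville_of_windowLiouville` — the crux BY NAME from B5b (CONDITIONAL; B5b = the open window
  `α ≈ 1` of Pineau–Vicol Conj. 1.1; this is also the single open stub `stub_windowLiouville` of this crux's own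
  skeleton `Cruxes/SpiralScalingLiouville/Lines/birth.lean`).

Consequence for planners (census, kernel-checked): stmt-8216 ⇔ stmt-4053 ⇔ B5b(1217) ⇔ PV Conj. 1.1 (all `α`); one
proof of the window statement closes all three leaves; nothing here closes the item.

References: Pineau–Vicol arXiv:2607.09619 Conj. 1.1, Thm 1.4 (pp. 3–4); Tsai GSM 192 Conj. 8.9; Bradshaw–Tsai CPDE 42
(2017) §5 OP 5.2.
-/

noncomputable section

set_option linter.dupNamespace false

open Set Function
open Literature.Analysis.FluidPDE
open Summit.NavierStokesRegularity.NavierStokesRegularity.Theses.ExtremalTypeIConstant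

namespace Summit.NavierStokesRegularity.NavierStokesRegularity.Theorems

/-- **The crux `SpiralScalingLiouville` ⇔ Pineau–Vicol's Conjecture 1.1 in their class, for EVERY rotation rate**:
a classical Navier–Stokes solution on `[−1, 0)` with the apex Type-I bound `‖u(t,x)‖ ≤ C₀/(‖x‖ + √(−t))` which is
backwards rotated self-similar, `u = pvAnsatz α U` with `U ∈ C²`, has `U = 0` — for all `α` and all `C₀ > 0`.
(`spiralScalingLiouville_iff_symmetricLiouville` + `solitonBridge_symmetricLiouville_iff_rssLiouville`.)
[cite: PineauVicol2026, Conjecture 1.1 (arXiv:2607.09619 p. 3)] -/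
theorem spiralScalingLiouville_iff_rssLiouvillePV :
    SpiralScalingLiouville ↔
      ∀ C₀ : ℝ, 0 < C₀ → ∀ (α : ℝ) (u : ℝ → EuclideanSpace ℝ (Fin 3) → EuclideanSpace ℝ (Fin 3)) (p : ℝ → EuclideanSpace ℝ (Fin 3) → ℝ) (U : EuclideanSpace ℝ (Fin 3) → EuclideanSpace ℝ (Fin 3)), Literature.Analysis.FluidPDE.IsClassicalNSSolutionOn (Set.Ico (-1) 0) 1 0 u p → (∀ t ∈ Set.Ico (-1 : ℝ) 0, ∀ x : EuclideanSpace ℝ (Fin 3), ‖u t x‖ ≤ C₀ / (‖x‖ + Real.sqrt (-t))) → ContDiff ℝ 2 U → (∀ t ∈ Set.Ico (-1 : ℝ) 0, ∀ x : EuclideanSpace ℝ (Fin 3), u t x = Literature.Analysis.FluidPDE.pvAnsatz α (fun y _ => U y) t x) → U = 0 :=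
  spiralScalingLiouville_iff_symmetricLiouville.trans solitonBridge_symmetricLiouville_iff_rssLiouville

/-- **The crux `SpiralScalingLiouville` ⇔ WINDOW LIOUVILLE (B5b of crux `Target`, stmt-1217, VERBATIM)**: Type-I RSS
solitons of Pineau–Vicol's class with rotation rate in a compact window `0 < a₀ ≤ |α| ≤ A₀`, equipped with a rotating
conjugate density `m` (Gaussian two-sided and gradient bounds, `Δm + ∇·(m(U + ½y − αJy)) = 0`) obeying the soliton
law `∫|curl U|²m ≤ 4α²` and identity `∫|curl U|²m = 2α∫(curl U)₂m`, are trivial. The window statement is also the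
single open stub `stub_windowLiouville` of this crux's skeleton. (`spiralScalingLiouville_iff_symmetricLiouville` +
`solitonBridge_windowLiouville_iff_symmetricLiouville`.)
[cite: PineauVicol2026, Conjecture 1.1 and Theorem 1.4 (arXiv:2607.09619 pp. 3–4)] -/
theorem spiralScalingLiouville_iff_windowLiouville :
    SpiralScalingLiouville ↔
      ∀ C₀ : ℝ, 0 < C₀ → ∀ a₀ A₀ : ℝ, 0 < a₀ → a₀ ≤ A₀ → ∀ α : ℝ, a₀ ≤ |α| → |α| ≤ A₀ → ∀ (u : ℝ → EuclideanSpace ℝ (Fin 3) → EuclideanSpace ℝ (Fin 3)) (p : ℝ → EuclideanSpace ℝ (Fin 3) → ℝ) (U : EuclideanSpace ℝ (Fin 3) → EuclideanSpace ℝ (Fin 3)) (m : EuclideanSpace ℝ (Fin 3) → ℝ) (c M₁ : ℝ), Literature.Analysis.FluidPDE.IsClassicalNSSolutionOn (Set.Ico (-1) 0) 1 0 u p → (∀ t ∈ Set.Ico (-1 : ℝ) 0, ∀ x : EuclideanSpace ℝ (Fin 3), ‖u t x‖ ≤ C₀ / (‖x‖ + Real.sqrt (-t))) → ContDiff ℝ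 2 U → (∀ t ∈ Set.Ico (-1 : ℝ) 0, ∀ x : EuclideanSpace ℝ (Fin 3), u t x = Literature.Analysis.FluidPDE.pvAnsatz α (fun y _ => U y) t x) → 0 < c → 0 < M₁ → (ContDiff ℝ 2 m ∧ (∀ y, 0 < m y) ∧ (∫ y, m y = 1) ∧ (∀ y, c * Real.exp (-(7 / 16 : ℝ) * ‖y‖ ^ 2) ≤ m y) ∧ (∀ y, m y ≤ M₁ * Real.exp (-(1 / 16 : ℝ) * ‖y‖ ^ 2)) ∧ (∃ M₂ : ℝ, ∀ y, ‖fderiv ℝ m y‖ ≤ M₂ * Real.exp (-(1 / 32 : ℝ) * ‖y‖ ^ 2)) ∧ (∀ y, Laplacian.laplacian m y + Literature.Analysis.FluidPDE.VectorCalculus.divergence (fun z => m z • (U z + (1 / 2 : ℝ) • z - α • Literature.Analysis.FluidPDE.rotGen z)) y = 0)) → (∫ y, ‖Literature.Analysis.FluidPDE.curl U y‖ ^ 2 * m y ≤ 4 * α ^ 2) → (∫ y, ‖Literature.Analysis.FluidPDE.curl U y‖ ^ 2 * m y = 2 * α * ∫ y, (Literature.Analysis.FluidPDE.curl U y) 2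 * m y) → U = 0 :=
  spiralScalingLiouville_iff_symmetricLiouville.trans solitonBridge_windowLiouville_iff_symmetricLiouville.symm

/-- **The crux `SpiralScalingLiouville` (stmt-NavierStokesRegularity-8216) BY NAME from WINDOW LIOUVILLE** (B5b of
crux `Target` = the single open stub `stub_windowLiouville` of this crux's skeleton; Pineau–Vicol Conj. 1.1 on the
window `α ≈ 1`). CONDITIONAL on the hypothesis; nothing here closes the item.
[cite: PineauVicol2026, Conjecture 1.1 (arXiv:2607.09619 p. 3)] -/
theorem spiralScalingLiouville_of_windowLiouville
    (hW : ∀ C₀ : ℝ, 0 < C₀ → ∀ a₀ A₀ : ℝ, 0 < a₀ → a₀ ≤ A₀ → ∀ α : ℝ, a₀ ≤ |α| → |α| ≤ A₀ → ∀ (u : ℝ → EuclideanSpace ℝ (Fin 3) → EuclideanSpace ℝ (Fin 3)) (p : ℝ → EuclideanSpace ℝ (Fin 3) → ℝ) (U : EuclideanSpace ℝ (Fin 3) → EuclideanSpace ℝ (Fin 3)) (m : EuclideanSpace ℝ (Fin 3) → ℝ) (c M₁ : ℝ), Literature.Analysis.FluidPDE.IsClassicalNSSolutionOn (Set.Ico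 (-1) 0) 1 0 u p → (∀ t ∈ Set.Ico (-1 : ℝ) 0, ∀ x : EuclideanSpace ℝ (Fin 3), ‖u t x‖ ≤ C₀ / (‖x‖ + Real.sqrt (-t))) → ContDiff ℝ 2 U → (∀ t ∈ Set.Ico (-1 : ℝ) 0, ∀ x : EuclideanSpace ℝ (Fin 3), u t x = Literature.Analysis.FluidPDE.pvAnsatz α (fun y _ => U y) t x) → 0 < c → 0 < M₁ → (ContDiff ℝ 2 m ∧ (∀ y, 0 < m y) ∧ (∫ y, m y = 1) ∧ (∀ y, c * Real.exp (-(7 / 16 : ℝ) * ‖y‖ ^ 2) ≤ m y) ∧ (∀ y, m y ≤ M₁ * Real.exp (-(1 / 16 : ℝ) * ‖y‖ ^ 2)) ∧ (∃ M₂ : ℝ, ∀ y, ‖fderiv ℝ m y‖ ≤ M₂ * Real.exp (-(1 / 32 : ℝ) * ‖y‖ ^ 2)) ∧ (∀ y, Laplacian.laplacian m y + Literature.Analysis.FluidPDE.VectorCalculus.divergence (fun z => m z • (U z + (1 / 2 : ℝ) • z - α • Literature.Analysis.FluidPDE.rotGen z)) y = 0)) → (∫ y, ‖Literature.Analysis.FluidPDE.curl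 U y‖ ^ 2 * m y ≤ 4 * α ^ 2) → (∫ y, ‖Literature.Analysis.FluidPDE.curl U y‖ ^ 2 * m y = 2 * α * ∫ y, (Literature.Analysis.FluidPDE.curl U y) 2 * m y) → U = 0) :
    SpiralScalingLiouville :=
  spiralScalingLiouville_iff_windowLiouville.2 hW

end Summit.NavierStokesRegularity.NavierStokesRegularity.Theorems

end
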